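import Summits.AtomisticToContinuum.FouriersLaw.Theses.BondHeatUncertainty

/-!
# `SubdiffusiveBondHeat` / bath-bond reduction, part 1: the generator identity at the bath site

Helper file for crux `stmt-AtomisticToContinuum-9120` (`BondHeatUncertainty.SubdiffusiveBondHeat`), line
`bath-bond-deficit-integral`, stub `stub_bathBondReduction` (fixed `N ≥ 2`:
`V_N(0,t) ≤ 4γT² ∫₀ᵗ (1 - θ_N) + 8 E_{μ_T}[e₀²]`). The reduction rests on the ENERGY BALANCE AT THE BATH
SITE `0`: for the local energy `e₀ = p₀²/2 + U(q₀) + ½ V(q₁ - q₀)` of a chain with `N ≥ 2` sites,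

  `L_{T_L,T_R} e₀ = -j₀ + γ (T_L - p₀²)`                                                    (G)

pointwise, where `L` is the generator `OscillatorChain.generator` of `FouriersLaw.lean` (Hamiltonian vector
field plus the two Ornstein–Uhlenbeck bath terms) and `j₀ = -½ (p₀ + p₁) V'(q₁ - q₀)` the bond current
`OscillatorChain.bondCurrent N 0` (BLR eq. (23)). In words: the energy of site `0` (kinetic + pinning +
half the bond) changes by minus the current through bond `(0,1)` and by the heat from the left bath,
`dQ^L = γ(T_L - p₀²) dt + √(2γT_L) p₀ dW`, whose drift is the bath term of (G). This is the
`f = e₀` instance of Dynkin's formula behind `∫₀ᵗ j₀ = Q^L_t - Δe₀` (Kundu–Dhar–Narayan bath-heat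
identity), proved here as a calculus identity for every `OscillatorChain` with differentiable potentials.
The lemmas are stated for a pair of sites `i0 ≠ i1` (values `0` and `1` where needed), and specialised at
the end to the literal indices `⟨0, _⟩, ⟨1, hN⟩` of the stub:

* `partialP_siteEnergy`, `partialP_partialP_siteEnergy`, `partialQ_siteEnergy` — the coordinate
  derivatives of `e₀` (`∂_{p_i} e₀ = [i=0] p₀`, `∂²_{p_i} e₀ = [i=0]`,
  `∂_{q_i} e₀ = [i=0](U'(q₀) - ½V'(q₁-q₀)) + [i=1] ½V'(q₁-q₀)`);
* `dPotential_siteZero` — `∂_{q₀} H = U'(q₀) - V'(q₁ - q₀)` (`N ≥ 2`);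
* `bondCurrent_siteZero` — `j₀ = -½(p₀ + p₁) V'(q₁ - q₀)` (`N ≥ 2`);
* `generator_siteEnergy` — (G) for differentiable `U, V`; `pinnedChain_generator_siteEnergy` — (G) for
  the pinned anharmonic chain, with `e₀` spelled exactly as in the stub's static term `8 ∫ e₀² dμ_T`.

Nothing here closes an item.
-/

noncomputable section

open MeasureTheory Filter Topology Set Finset
open Literature.MathematicalPhysics.KineticTheory.HeatConduction

namespace Summit.AtomisticToContinuum.FouriersLaw.Theorems.SubdiffusiveBondHeat

variable {N : ℕ}

/-! ### Coordinate derivatives of the bath-site energy -/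

section SiteEnergy

variable (P : OscillatorChain) {i0 i1 : Fin N} (h01 : i0 ≠ i1)
include h01

omit h01 in
/-- `∂_{p_i} e₀ = [i = i0] p_{i0}` for `e₀ = p_{i0}²/2 + U(q_{i0}) + ½V(q_{i1} - q_{i0})` (no hypothesis on
`U, V`: the potential part does not depend on the momenta). [folklore] -/
theorem partialP_siteEnergy (i : Fin N) (y : PhaseSpace N) :
    partialP i (fun z : PhaseSpace N => (z.2 i0) ^ 2 / 2 + P.U (z.1 i0) + P.V (z.1 i1 - z.1 i0) / 2) y =
      if i = i0 then y.2 i0 else 0 := by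
  unfold partialP
  by_cases hi : i = i0
  · subst hi
    simp only [Function.update_self, if_true]
    have h : HasDerivAt (fun t : ℝ => t ^ 2 / 2 + P.U (y.1 i) + P.V (y.1 i1 - y.1 i) / 2) (y.2 i) (y.2 i) := by
      have h1 := ((hasDerivAt_pow 2 (y.2 i)).div_const 2).add_const (P.U (y.1 i) + P.V (y.1 i1 - y.1 i) / 2)
      refine (h1.congr_deriv ?_).congr_of_eventuallyEq ?_
      · push_cast; ring
      · exact Eventually.of_forall fun t => by ring
    exact h.deriv
  · have hne : i0 ≠ i := Ne.symm hi
    simp only [hi, if_false, Function.update_of_ne hne, deriv_const']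

omit h01 in
/-- `∂_{p_i} e₀` as a function: `[i = i0] p_{i0}`. [folklore] -/
theorem partialP_siteEnergy_eq (i : Fin N) :
    partialP i (fun z : PhaseSpace N => (z.2 i0) ^ 2 / 2 + P.U (z.1 i0) + P.V (z.1 i1 - z.1 i0) / 2) =
      fun y => if i = i0 then y.2 i0 else 0 :=
  funext fun y => partialP_siteEnergy P i y

omit h01 in
/-- `∂²_{p_i} e₀ = [i = i0]`. [folklore] -/
theorem partialP_partialP_siteEnergy (i : Fin N) (y : PhaseSpace N) :
    partialP i (partialP i (fun z : PhaseSpace N => (z.2 i0) ^ 2 / 2 + P.U (z.1 i0) + P.V (z.1 i1 - z.1 i0) / 2)) y =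
      if i = i0 then 1 else 0 := by
  rw [partialP_siteEnergy_eq P i]
  unfold partialP
  by_cases hi : i = i0
  · subst hi
    simp only [if_true, Function.update_self]
    exact (hasDerivAt_id' (y.2 i)).deriv
  · simp only [hi, if_false, deriv_const']

/-- `∂_{q_i} e₀ = [i = i0] (U'(q_{i0}) - ½ V'(q_{i1} - q_{i0})) + [i = i1] ½ V'(q_{i1} - q_{i0})` for
differentiable `U, V` (the two cases are exclusive). [folklore] -/
theorem partialQ_siteEnergy (hU : Differentiable ℝ P.U) (hV : Differentiable ℝ P.V) (i : Fin N)
    (y : PhaseSpace N) :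
    partialQ i (fun z : PhaseSpace N => (z.2 i0) ^ 2 / 2 + P.U (z.1 i0) + P.V (z.1 i1 - z.1 i0) / 2) y =
      if i = i0 then deriv P.U (y.1 i0) - deriv P.V (y.1 i1 - y.1 i0) / 2
      else if i = i1 then deriv P.V (y.1 i1 - y.1 i0) / 2 else 0 := by
  unfold partialQ
  by_cases hi : i = i0
  · subst hi
    simp only [if_true, Function.update_self, Function.update_of_ne (Ne.symm h01)]
    -- `t ↦ p₀²/2 + U(t) + V(q₁ - t)/2`
    have hUd := (hU (y.1 i)).hasDerivAt
    have hlin : HasDerivAt (fun t : ℝ => y.1 i1 - t) (-1) (y.1 i) := by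
      simpa using (hasDerivAt_id' (y.1 i)).const_sub (y.1 i1)
    have hVd : HasDerivAt (fun t : ℝ => P.V (y.1 i1 - t)) (deriv P.V (y.1 i1 - y.1 i) * (-1)) (y.1 i) :=
      (hV _).hasDerivAt.comp _ hlin
    have h := ((hUd.const_add ((y.2 i) ^ 2 / 2)).add (hVd.div_const 2))
    have h' : HasDerivAt (fun t : ℝ => (y.2 i) ^ 2 / 2 + P.U t + P.V (y.1 i1 - t) / 2)
        (deriv P.U (y.1 i) - deriv P.V (y.1 i1 - y.1 i) / 2) (y.1 i) := by
      refine h.congr_deriv ?_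
      ring
    exact h'.deriv
  · simp only [hi, if_false]
    by_cases hi1 : i = i1
    · subst hi1
      simp only [if_true, Function.update_self, Function.update_of_ne h01]
      -- `t ↦ p₀²/2 + U(q₀) + V(t - q₀)/2`
      have hlin : HasDerivAt (fun t : ℝ => t - y.1 i0) 1 (y.1 i) := by
        simpa using (hasDerivAt_id' (y.1 i)).sub_const (y.1 i0)
      have hVd : HasDerivAt (fun t : ℝ => P.V (t - y.1 i0)) (deriv P.V (y.1 i - y.1 i0) * 1) (y.1 i) :=
        (hV _).hasDerivAt.comp _ hlin
      have h := (hVd.div_const 2).const_add ((y.2 i0) ^ 2 / 2 + P.U (y.1 i0))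
      have h' : HasDerivAt (fun t : ℝ => (y.2 i0) ^ 2 / 2 + P.U (y.1 i0) + P.V (t - y.1 i0) / 2)
          (deriv P.V (y.1 i - y.1 i0) / 2) (y.1 i) := by
        refine (h.congr_deriv ?_).congr_of_eventuallyEq (Eventually.of_forall fun t => ?_)
        · ring
        · simp only [add_assoc]
      exact h'.deriv
    · simp only [hi1, if_false]
      have hne0 : i0 ≠ i := Ne.symm hi
      have hne1 : i1 ≠ i := Ne.symm hi1
      simp only [Function.update_of_ne hne0, Function.update_of_ne hne1, deriv_const']

omit h01 in
/-- `∂_{q₀} H = ∂Φ/∂q₀ = U'(q₀) - V'(q₁ - q₀)` on a chain with `N ≥ 2` sites (closed form of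
`OscillatorChain.dPotential` at the left end `i0 = 0`, `i1 = 1`: only the bond `(0,1)` touches site `0`).
[folklore] -/
theorem dPotential_siteZero (hi0 : i0.val = 0) (hi1 : i1.val = 1) (q : Fin N → ℝ) :
    P.dPotential N i0 q = deriv P.U (q i0) - deriv P.V (q i1 - q i0) := by
  have h01 : i0 ≠ i1 := by
    intro h; have := congrArg Fin.val h; omega
  unfold OscillatorChain.dPotential
  -- only `k = i0` contributes to the outer sum
  rw [Fintype.sum_eq_single i0]
  · -- only `l = i1` contributes to the inner sum
    rw [Fintype.sum_eq_single i1]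
    · have hc : i1.val = i0.val + 1 := by omega
      simp only [hc, if_true, h01.symm, if_false]
      ring
    · intro l hl
      have hl1 : ¬ (l.val = i0.val + 1) := by
        intro h; apply hl; exact Fin.ext (by omega)
      simp only [hl1, if_false]
  · intro k hk
    refine Finset.sum_eq_zero fun l _ => ?_
    by_cases hlk : l.val = k.val + 1
    · have hl0 : l ≠ i0 := by
        intro h; have := congrArg Fin.val h; omega
      simp only [hlk, if_true, hl0, hk, if_false, sub_self, mul_zero]
    · simp only [hlk, if_false]

omit h01 in
/-- The bond current through the bath bond `(0, 1)`: `j₀ = -½ (p₀ + p₁) V'(q₁ - q₀)` (closed form of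
`OscillatorChain.bondCurrent N i0` when `i1 = i0 + 1` is a site). [folklore] -/
theorem bondCurrent_siteZero (hi : i1.val = i0.val + 1) (x : PhaseSpace N) :
    P.bondCurrent N i0 x = -((x.2 i0 + x.2 i1) / 2 * deriv P.V (x.1 i1 - x.1 i0)) := by
  unfold OscillatorChain.bondCurrent
  rw [Fintype.sum_eq_single i1]
  · simp [hi]
  · intro j hj
    have hj1 : ¬ (j.val = i0.val + 1) := by
      intro h; apply hj; exact Fin.ext (by omega)
    simp only [hj1, if_false]

/-! ### The generator identity `L e₀ = -j₀ + γ (T_L - p₀²)` -/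

omit h01 in
/-- **The generator identity at the bath site** (`N ≥ 2`, differentiable potentials; `i0, i1` the
sites `0, 1`): `L_{T_L,T_R} e₀ = -j₀ + γ (T_L - p₀²)` for `e₀ = p₀²/2 + U(q₀) + ½V(q₁ - q₀)`,
`j₀ = -½(p₀ + p₁)V'(q₁ - q₀)`. The Hamiltonian part of `L` gives `-j₀`
(`p₀(U' - ½V') + ½p₁V' - (U' - V')p₀ = ½(p₀+p₁)V'`), the left bath gives `γ(T_L ∂²_{p₀} - p₀∂_{p₀})e₀ =
γ(T_L - p₀²)`, and the right bath acts on `p_{N-1} ≠ p₀` (`N ≥ 2`), on which `e₀` does not depend.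
[Bonetto–Lebowitz–Rey-Bellet 2000, §5.2 eq. (23)–(25) (local energy balance defining the current)]
[folklore] -/
theorem generator_siteEnergy (hU : Differentiable ℝ P.U) (hV : Differentiable ℝ P.V)
    (hi0 : i0.val = 0) (hi1 : i1.val = 1) (T_L T_R : ℝ) (x : PhaseSpace N) :
    P.generator N T_L T_R (fun z : PhaseSpace N => (z.2 i0) ^ 2 / 2 + P.U (z.1 i0) + P.V (z.1 i1 - z.1 i0) / 2) x =
      -P.bondCurrent N i0 x + P.γ * (T_L - (x.2 i0) ^ 2) := by
  have h01 : i0 ≠ i1 := by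
    intro h; have := congrArg Fin.val h; omega
  have hN : 1 < N := by have := i1.isLt; omega
  unfold OscillatorChain.generator
  simp only [partialP_siteEnergy P (i0 := i0) (i1 := i1), partialP_partialP_siteEnergy P (i0 := i0) (i1 := i1),
    partialQ_siteEnergy P h01 hU hV, P.partialQ_hamiltonian_eq_dPotential hU hV]
  -- the Hamiltonian part
  have hham : ∑ i : Fin N, (x.2 i * (if i = i0 then deriv P.U (x.1 i0) - deriv P.V (x.1 i1 - x.1 i0) / 2
      else if i = i1 then deriv P.V (x.1 i1 - x.1 i0) / 2 else 0) -
      P.dPotential N i x.1 * (if i = i0 then x.2 i0 else 0)) =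
      (x.2 i0 + x.2 i1) / 2 * deriv P.V (x.1 i1 - x.1 i0) := by
    rw [Fintype.sum_eq_add i0 i1 h01]
    · simp only [if_true, h01.symm, if_false, dPotential_siteZero P hi0 hi1]
      ring
    · intro i ⟨hi, hi'⟩
      simp only [hi, hi', if_false]
      ring
  -- the bath part
  have hbath : ∑ i : Fin N, ((if i.val = 0 then T_L * (if i = i0 then (1 : ℝ) else 0) -
      x.2 i * (if i = i0 then x.2 i0 else 0) else 0) +
      (if i.val = N - 1 then T_R * (if i = i0 then (1 : ℝ) else 0) - x.2 i * (if i = i0 then x.2 i0 else 0)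
        else 0)) = T_L - x.2 i0 ^ 2 := by
    rw [Fintype.sum_eq_single i0]
    · have hN1 : ¬ (i0.val = N - 1) := by omega
      rw [if_pos hi0, if_neg hN1]
      simp only [if_true]
      ring
    · intro i hi
      simp only [hi, if_false, mul_zero, sub_self, ite_self, add_zero]
  rw [hham, hbath, bondCurrent_siteZero P (i0 := i0) (i1 := i1) (by omega) x]
  ring

end SiteEnergy

/-! ### The pinned anharmonic chain -/

/-- **(G) for the pinned anharmonic chain** `pinnedChain ω₂ lam β γ` (all real parameters; `N ≥ 2`), with
the bath-site energy `e₀ = p₀²/2 + U(q₀) + ½ V(q₁ - q₀)` written literally as in the static term of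
`stub_bathBondReduction`: `L_{T_L,T_R} e₀ = -j₀ + γ (T_L - p₀²)` pointwise. At `T_L = T_R = T` this is the
drift of the bath-heat decomposition `∫₀ᵗ j₀ = Q^L_t - Δe₀`, `dQ^L = γ(T - p₀²)dt + √(2γT) p₀ dW`.
[folklore] -/
theorem pinnedChain_generator_siteEnergy :
    ∀ (ω₂ lam β γ T_L T_R : ℝ) (N : ℕ) (hN : 1 < N) (x : PhaseSpace N),
      (pinnedChain ω₂ lam β γ).generator N T_L T_R (fun z : PhaseSpace N =>
          (z.2 ⟨0, Nat.zero_lt_of_lt hN⟩) ^ 2 / 2 + (pinnedChain ω₂ lam β γ).U (z.1 ⟨0, Nat.zero_lt_of_lt hN⟩) +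
            (pinnedChain ω₂ lam β γ).V (z.1 ⟨1, hN⟩ - z.1 ⟨0, Nat.zero_lt_of_lt hN⟩) / 2) x =
        -(pinnedChain ω₂ lam β γ).bondCurrent N ⟨0, Nat.zero_lt_of_lt hN⟩ x +
          γ * (T_L - (x.2 ⟨0, Nat.zero_lt_of_lt hN⟩) ^ 2) := by
  intro ω₂ lam β γ T_L T_R N hN x
  have hU : Differentiable ℝ (pinnedChain ω₂ lam β γ).U :=
    (pinnedChain_contDiff_U ω₂ lam β γ (n := 1)).differentiable one_ne_zero
  have hV : Differentiable ℝ (pinnedChain ω₂ lam β γ).V :=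
    (pinnedChain_contDiff_V ω₂ lam β γ (n := 1)).differentiable one_ne_zero
  exact generator_siteEnergy (pinnedChain ω₂ lam β γ) hU hV rfl rfl T_L T_R x

end Summit.AtomisticToContinuum.FouriersLaw.Theorems.SubdiffusiveBondHeat
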